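import Summits.Schanuel.Schanuel.Theses.DiophantineDichotomy
import Summits.Schanuel.Schanuel.Theorems.ApproximationProperty.Negative.Shape
import Summits.Schanuel.Schanuel.Theorems.ApproximationProperty.Negative.ScaleExponentLiouville

/-!
# Line `cluster-killing-own-level` — skeleton for crux `DiophantineDichotomy.ApproximationProperty`
# (stmt-Schanuel-6117, route-Schanuel-DiophantineDichotomy, rank 3)

See `Lines/cluster-killing-own-level.md` (the line card) for the prose: idea, stubs, hardest stub,
barriers, Disproof used, triage answers.

THE CRUX. Philippon's approximation property, pointwise affine form in the `(d, log H)` currency: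
`θ ∈ ℂ^ι`, `trdeg_ℚ ℚ(θ) ≤ t`, `1 ≤ t` ⟹ `∃ c ≥ 1 ∀ Y ≥ Δ ≥ c ∃ γ ∈ ℚ̄^ι, d, H` with
`[ℚ(γ):ℚ] ≤ d ≤ (cΔ)ᵗ`, every `γᵢ` a root of a non-zero `P ∈ ℤ[X]` of degree `≤ d` and height `≤ H`,
`log H ≤ cYΔ^{t-1}`, `‖γ − θ‖ ≤ exp(−(log H·Δ + d·Y)/c)` (= AP2 of Nesterenko–Philippon LNM 1752
Ch. 4 §4 p. 61 — known `t ≤ 2`, open `t ≥ 3`).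

THE LINE (card `Ideas/cluster-killing-own-level.md`, triage r1: 3 × pass). What elimination
delivers — and what is PRINTED for `n ≤ 3` (AP1 with `d = 0`, LNM 1752 p. 61) — is the 0-CYCLE
property: a Galois orbit close to `θ` ON AVERAGE, `Σ_σ log⁺ 1/‖σβ − θ‖ ≥ P := (S·Δ + d·Y)/c`. The
crux is the POINT property (one close conjugate). The lever turning the first into the second is an
AUXILIARY INTEGER FORM `g` of LOW LEVEL `D₀ = ⌊Δ/K⌋` built on monomials whose values at `β` are
`ℚ`-linearly independent (so `g(β) ≠ 0` for free), Dirichlet-small at `θ`, with UNBUDGETED height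
`T = P/(24d)`: the product formula for `g(β) ∈ ℚ(β)×` ("Liouville along the orbit" = second metric
Bézout on the EMPTY cycle, LNM 1752 Ch. 8 Cor. 0.8 pp. 164–165) caps the proximity a cluster of
conjugates can carry by `n·D₀·S + 3dT + o(P) < P/2`, so one conjugate carries `P·c/c'`
(`stub_orbitExtraction`, provable now — THE LEVER). Its only input about the orbit is a
POSTULATION COUNT at the scale's level: `r` monomials of degree `≤ ⌊Δ/K⌋` independent on the orbit
with `d ≤ n!(Kc)ⁿ·r` (`Postulates`). That count — not ambient genericity — is what the cycle
property is asked to deliver (`CycleAPPostulated` = the card's `C_cycle⁺`, corrected: see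
"Self-refutation" in the line card — ambient `D*`-genericity is FALSE as an output requirement at
every `θ` on or near a rational line, by Liouville on the line's equation; the postulation count
survives because an orbit enveloped by a cheap `W` has `|O| ≤ deg W·Δ^{dim W}` (Bézout) against
`H_O(Δ/K) ≳ deg W·(Δ/K)^{dim W}` (Chardin–Philippon on the carrier + uniform position of the last
cut), so enveloped outputs of the descent are extracted exactly like generic ones and NO feedback /
envelope recursion is needed — the triage's termination objection disappears structurally).
`stub_cyclePostulatedLow` (`n ≤ 3`: Philippon 2000's descent re-run with a uniform-position last cut;
the reachable hard stub) and `stub_cyclePostulatedHigh` (`n ≥ 4`: Philippon's open AP1(`d = 0`) — the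
sibling card `arithmetic-chardin-philippon` — with the same last cut). The fourth stub is the
audited currency change `stub_currencyLifting`: Philippon's currency `(d(α), d(α)h(α))` at the
generic point of `ℚ(θ)` ⟹ the crux's per-coordinate naive currency on `ℂ^ι` (transcendence basis,
implicit roots, Mahler measure → naive height), done from `(d, d·h)` as all three triagers demanded.

`ApproximationProperty_of : ApproximationProperty` composes the four stubs into the crux BY NAME
(kernel-checked; no `sorry` outside the four `stub_*`, which it invokes): stubs 1+2 (cycle property
with postulation, all `n ≥ 1`) + stub 3 (generic extraction) ⟹ `PointAP n` (`pointAP_of`, proved: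
pure logic + monotone budgets) ⟹ crux (stub 4, `CurrencyLifting`). The corollary
`apSlice_le_three_of` records the line's stand-alone pay-off: stubs 1, 3, 4 alone give the crux for
`t ≤ 3` (the first open case `t = 3` included).

## Disproof used (`Cruxes/ApproximationProperty/Disproof.lean` v5, cdisprove 2026-08-16, rc 0)
* §1 `approximationProperty_false_without_pos_t` = landed
  `Theorems.ApproximationPropertyShape.false_without_pos_t` — HONOURED: every statement here has
  `1 ≤ n` / `1 ≤ t`; the line USES `1 ≤ t` at `stub_currencyLifting` (the `t₀ = 0` branch, algebraic
  `θ`, needs the degree budget `(cΔ)ᵗ ≥ cΔ ≥ d(θ)`), and `1 ≤ n` at `stub_orbitExtraction`.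
* §2 `approximationProperty_uniform_false` = landed `….false_with_uniform_constant` — HONOURED:
  all constants are pointwise (`∀ θ ∃ c`): `CycleAPPostulated`, `OrbitExtraction` (its `K`, `c'`
  carry `log⁺‖θ‖`), `PointAP`, `APSlice`.
* §3 `not_apScaleWith_liouville` / `apScaleExponentDegOne_false` = landed
  `Theorems.ApproximationPropertyScaleExponentLiouville.scaleExponent_false` — HONOURED: every
  accuracy is OUTPUT-dependent, `exp(−(S·Δ + d·Y)/c)` with `(d, S)` the output's degree and size;
  no scale exponent `exp(−ΔY/c)` anywhere (a Liouville `θ` is served by its cheap convergent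
  `a/b` itself: `d = 1`, `S = log max(|a|,|b|)`, exactly as §3's `repulsion` forces).
* §4 `apAt_of_forall_isAlgebraic` — consistent: algebraic `θ` (`trdeg = 0`) is the `t₀ = 0` branch
  of `stub_currencyLifting` (`γ = θ`), and `CycleAPPostulated`/`PointAP` hold at algebraic `θ ∈ ℂⁿ`
  with `β = θ`, `s = {θ}`, `r = 1` (the monomial `1`).
* Landed Negative lemmas are IMPORTED above and named in §6: no statement of this file has a
  refuted shape.
* `ledger negatives --problem Schanuel` = stmt-Schanuel-6844/6846 (PolarPhantoms): unrelated.
-/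

set_option linter.dupNamespace false
set_option linter.unusedVariables false

noncomputable section

namespace Summit.Schanuel.Schanuel.Cruxes.ApproximationProperty.ClusterKillingOwnLevel

open Summit.Schanuel.Schanuel.Theses.DiophantineDichotomy (ApproximationProperty)
open Polynomial

/-! ## §1 Vocabulary: algebraic points of `ℂⁿ` in Philippon's currency `(d, S) = (d(α), d(α)·h(α))` -/

variable {n : ℕ}

/-- `β'` is a CONJUGATE of `β ∈ ℂⁿ` over `ℚ`: every `ℚ`-polynomial relation of `β` holds at `β'`
(inclusion of the ideals of relations; for algebraic `β` the ideal is maximal, so this is equality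
and `β' = σβ` for an embedding `σ : ℚ(β) → ℂ`; there are exactly `[ℚ(β):ℚ]` conjugates). -/
def IsConj (β β' : Fin n → ℂ) : Prop :=
  ∀ F : MvPolynomial (Fin n) ℚ, MvPolynomial.aeval β F = 0 → MvPolynomial.aeval β' F = 0

/-- **Size certificate** `SizeCert β d S`: `0 ≤ S`, `[ℚ(β):ℚ] ≤ d`, and every coordinate `βᵢ` is a
root of an IRREDUCIBLE `Pᵢ ∈ ℤ[X]` (hence `±` its primitive minimal polynomial: `deg Pᵢ = deg βᵢ`,
`log M(Pᵢ) = deg βᵢ · h(βᵢ)`) with `d · log M(Pᵢ) ≤ deg Pᵢ · S`, i.e. `S ≥ d · maxᵢ h(βᵢ)` —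
Philippon's `d(α)h(α)` up to the factor `n` (`h(βᵢ) ≤ h(1:β) ≤ Σᵢ h(βᵢ)`). Irreducibility is what
makes `S` honest (a reducible certificate padded with cyclotomic factors would under-report the
size by a factor `d`; triage r1-2); `0 ≤ S` is implied by the rest (`M ≥ 1`, `deg ≥ 1`) and only
recorded to keep the glue free of that lemma. Naive height of the certificate:
`log H(Pᵢ) ≤ deg Pᵢ·log 2 + log M(Pᵢ) ≤ d log 2 + S` (Mathlib `norm_coeff_le_choose_mul_mahlerMeasure`). -/
def SizeCert {ι : Type} (β : ι → ℂ) (d : ℕ) (S : ℝ) : Prop :=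
  0 ≤ S ∧ Module.finrank ℚ ↥(IntermediateField.adjoin ℚ (Set.range β)) ≤ d ∧
  ∀ i, ∃ P : ℤ[X], Irreducible P ∧ Polynomial.aeval (β i) P = 0 ∧
    (d : ℝ) * Real.log ((P.map (Int.castRingHom ℂ)).mahlerMeasure) ≤ (P.natDegree : ℝ) * S

/-- **Budgets** of AP in dimension `n` at scale `(Δ, Y)` with constant `c`: `d ≤ (cΔ)ⁿ`,
`S ≤ c·Y·Δ^{n-1}` (AP2's `d(α) ≤ (c'Δ)ⁿ`, `d(α)h(α) ≤ c'ⁿ H Δ^{n-1}`, LNM 1752 p. 61). -/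
def InBudget (n : ℕ) (c Δ Y : ℝ) (d : ℕ) (S : ℝ) : Prop :=
  (d : ℝ) ≤ (c * Δ) ^ n ∧ S ≤ c * Y * Δ ^ (n - 1)

/-- **Orbit proximity** `OrbitClose θ β s P`: `s` is a finite set of conjugates of `β` whose TOTAL
proximity to `θ` is at least `P`: `∏_{β' ∈ s} min(1, ‖β' − θ‖) ≤ e^{−P}` (multiplicative form of
`Σ_{β'∈s} log⁺ 1/‖β' − θ‖ ≥ P`, free of `log 0` junk; affine shadow of `log Dist(θ, Z_β) ≤ −P` for
the 0-cycle `Z_β`, LNM 1752 Ch. 4 §4 / Ch. 7). -/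
def OrbitClose (θ β : Fin n → ℂ) (s : Finset (Fin n → ℂ)) (P : ℝ) : Prop :=
  (∀ β' ∈ s, IsConj β β') ∧ (∏ β' ∈ s, min 1 ‖β' - θ‖) ≤ Real.exp (-P)

/-- **Postulation count** `Postulates β D r`: there are `r` monomials of total degree `≤ D` whose
values at `β` are `ℚ`-LINEARLY INDEPENDENT (equivalently: independent modulo the ideal of the
Galois orbit `O` of `β`; so `r ≤ H_O(D) ≤ min([ℚ(β):ℚ], binom(D+n, n))`, `H_O` = Hilbert function
of the orbit). This — at the SCALE's level `D = ⌊Δ/K⌋`, not at the orbit's "own" level — is all the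
extraction needs (its Dirichlet box runs over these monomials, so the auxiliary form misses the
orbit for free), and it is what descent outputs have in every regime: generic orbits
(`H_O(D) = min(d, N(D))`), orbits on a cheap subvariety `W` (`|O| ≤ deg W·Δ^{dim W}` by Bézout vs
`H_O(Δ/K) ≥ H_W`-type lower bounds, Chardin–Philippon), orbits on a rational line at `θ = (π, π)`
(`H_O(D) = min(d, D+1)`). `r = 0` is trivially postulated; `r = 1` by the monomial `1`. -/
def Postulates (β : Fin n → ℂ) (D r : ℕ) : Prop :=
  ∃ E : Finset (Fin n → ℕ), r ≤ E.card ∧ (∀ e ∈ E, ∑ i, e i ≤ D) ∧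
    LinearIndependent ℚ (fun e : ↥E => ∏ i, β i ^ ((e : Fin n → ℕ) i))

/-! ## §2 The three statements of the line in dimension `n` -/

/-- **`CycleAPPostulated n` — the 0-cycle approximation property WITH POSTULATION** (the card's
`C_cycle⁺(n)`, corrected from "generic" to "postulated at the scale's level"): every `θ ∈ ℂⁿ` has a
constant `c(θ) ≥ 1` such that for every level parameter `K ≥ 1` and all scales `Y ≥ Δ ≥ Δ₀(θ, K)`
there is an algebraic point `β` with size certificate `(d, S)` in budget, a set `s` of conjugates
of total proximity `≥ (S·Δ + d·Y)/c`, and `r` monomials of degree `≤ ⌊Δ/K⌋` independent on the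
orbit with `d ≤ n!·(Kc)ⁿ·r`. Without the last clause this is Philippon's AP1 with `d = 0`
(LNM 1752 p. 61: printed for `n ≤ 3`, Philippon JNT 81 (2000); conjecture for `n ≥ 4`) read on the
best orbit of the 0-cycle; the clause holds for the descent's output orbit `O ⊂ Z₂·Z(fₙ)` (`Z₂` the
carrier curve, a component of `V(f₁,…,f_{n-1})` of degree `δ₂`, `|O| ≤ δ₂Δ`) as soon as the last
cut `fₙ` is in uniform position w.r.t. `Z₂` (then `H_O(D) = min(|O|, H_{Z₂}(D))`) by
Chardin–Philippon's lower bound `H_{Z₂}(Δ/K) ≫ₙ δ₂Δ/Kⁿ`. -/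
def CycleAPPostulated (n : ℕ) : Prop :=
  ∀ θ : Fin n → ℂ, ∃ c : ℝ, 1 ≤ c ∧ ∀ K : ℕ, 1 ≤ K → ∃ Δ₀ : ℝ, ∀ Δ Y : ℝ, Δ₀ ≤ Δ → Δ ≤ Y →
    ∃ (β : Fin n → ℂ) (d : ℕ) (S : ℝ) (s : Finset (Fin n → ℂ)) (r : ℕ),
      SizeCert β d S ∧ InBudget n c Δ Y d S ∧
      OrbitClose θ β s ((S * Δ + d * Y) / c) ∧
      Postulates β ⌊Δ / K⌋₊ r ∧ (d : ℝ) ≤ (n.factorial : ℝ) * ((K : ℝ) * c) ^ n * r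

/-- **`OrbitExtraction n` — THE LEVER (extraction lemma, cycle → point).** For every `θ ∈ ℂⁿ`
and cycle constant `c ≥ 1` there are a level parameter `K ≥ 1` and `c' ≥ c` (both depending on
`n`, `c`, `log⁺‖θ‖` only) such that at every scale `Y ≥ Δ ≥ c'`: if `β` has size certificate
`(d, S)` with `d ≤ (cΔ)ⁿ`, a set of conjugates of total proximity `P = (S·Δ + d·Y)/c`, and `r`
monomials of degree `≤ ⌊Δ/K⌋` independent on its orbit with `d ≤ n!(Kc)ⁿ r`, then SOME conjugate
`β'` of `β` (same certificate) satisfies `‖β' − θ‖ ≤ exp(−(S·Δ + d·Y)/c')`.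
Proof route (numerology re-derived in the line card, answering triage r1-1/2/3): `λ := 1/(n!(Kc)ⁿ)`.
(A) `d < 8/λ`: trivially some `β' ∈ s` has `‖β' − θ‖ ≤ e^{−P/|s|}`, `|s| ≤ d`. (B) `d ≥ 8/λ`, so
`r ≥ 8`: Dirichlet on `g = Σ_{e∈E} aₑ xᵉ`, `|aₑ| ≤ e^T`, `T = P/(24d) ≥ 1`:
`log 1/|g(θ)| ≥ (r/2 − 1)T − log 4r − ⌊Δ/K⌋·log⁺‖θ‖`; `g(β) ≠ 0` by independence. (C) product
formula on `ℚ(β)` for `g(β)`: `−Σ_{σ∈C} log|g(σβ)| ≤ d(log 2r + T) + n⌊Δ/K⌋S` (finite places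
`≤ 0` beyond `D₀Σᵢlog⁺|βᵢ|_w`, and `Σ_w log⁺|βᵢ|_w = d'h(βᵢ) ≤ S`). (D) for the cluster `C` of
conjugates in `s` closer than `e^{−P/(2d)}` (it carries `≥ P/2`), if none is within `e^{−Pc/c'}`:
`|g(σβ)| ≤ 2·Lip·‖σβ − θ‖`, whence `P/2 ≤ d(2T + 3log(4nrΔ) + ⌊Δ/K⌋log⁺‖θ‖) + n⌊Δ/K⌋S ≤ P/4`
for `K ≥ 36nc(1 + log⁺‖θ‖)`, `c' ≥ 192c/λ`, `Δ ≥ c'(n, c, θ)` — contradiction. -/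
def OrbitExtraction (n : ℕ) : Prop :=
  ∀ (θ : Fin n → ℂ) (c : ℝ), 1 ≤ c → ∃ (K : ℕ) (c' : ℝ), 1 ≤ K ∧ c ≤ c' ∧
    ∀ Δ Y : ℝ, c' ≤ Δ → Δ ≤ Y →
    ∀ (β : Fin n → ℂ) (d : ℕ) (S : ℝ) (s : Finset (Fin n → ℂ)) (r : ℕ),
      SizeCert β d S → (d : ℝ) ≤ (c * Δ) ^ n →
      OrbitClose θ β s ((S * Δ + d * Y) / c) →
      Postulates β ⌊Δ / K⌋₊ r → (d : ℝ) ≤ (n.factorial : ℝ) * ((K : ℝ) * c) ^ n * r →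
      ∃ β' : Fin n → ℂ, IsConj β β' ∧ SizeCert β' d S ∧
        ‖β' - θ‖ ≤ Real.exp (-((S * Δ + d * Y) / c'))

/-- **`PointAP n` — the point approximation property in dimension `n`, Philippon currency**
(AP2 of LNM 1752 p. 61 at the affine point `θ ∈ ℂⁿ`, pointwise constant, sizes via `SizeCert`):
the common output of cycle + extraction, and the input of the currency lifting. It is the crux's
own instance `ι = Fin n`, `t = n` up to the change of currency `S ↔ log H` (`|Δ log H − Δ S| ≤
Δ d log 2 ≤ d Y`). NOT a stub: derived (`pointAP_of`). -/
def PointAP (n : ℕ) : Prop :=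
  ∀ θ : Fin n → ℂ, ∃ c : ℝ, 1 ≤ c ∧ ∀ Δ Y : ℝ, c ≤ Δ → Δ ≤ Y →
    ∃ (β : Fin n → ℂ) (d : ℕ) (S : ℝ), SizeCert β d S ∧ InBudget n c Δ Y d S ∧
      ‖β - θ‖ ≤ Real.exp (-((S * Δ + d * Y) / c))

/-! ## §3 The crux slice at exponent `t` and the currency lifting -/

/-- **`APSlice t`** — the crux at a FIXED exponent `t`, verbatim its matrix (all finite `ι`, all
`θ` with `trdeg ℚ(θ) ≤ t`); `ApproximationProperty ↔ ∀ t ≥ 1, APSlice t` definitionally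
(`approximationProperty_iff_apSlice`). -/
def APSlice (t : ℕ) : Prop :=
  ∀ (ι : Type) [Fintype ι] (θ : ι → ℂ),
    Algebra.trdeg ℚ ↥(IntermediateField.adjoin ℚ (Set.range θ)) ≤ (t : Cardinal) →
    ∃ c : ℝ, 1 ≤ c ∧ ∀ Δ Y : ℝ, c ≤ Δ → Δ ≤ Y → ∃ (γ : ι → ℂ) (d H : ℕ),
      Module.finrank ℚ ↥(IntermediateField.adjoin ℚ (Set.range γ)) ≤ d ∧
      (∀ i, ∃ P : Polynomial ℤ, P ≠ 0 ∧ P.natDegree ≤ d ∧ (∀ k, |P.coeff k| ≤ (H : ℤ)) ∧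
        Polynomial.aeval (γ i) P = 0) ∧
      (d : ℝ) ≤ (c * Δ) ^ t ∧ Real.log H ≤ c * Y * Δ ^ (t - 1) ∧
      ‖γ - θ‖ ≤ Real.exp (-((Real.log H * Δ + d * Y) / c))

/-- The crux is the conjunction of its slices (definitional). -/
theorem approximationProperty_iff_apSlice :
    ApproximationProperty ↔ ∀ t : ℕ, 1 ≤ t → APSlice t := by
  constructor
  · intro h t ht ι _ θ hθ
    exact h ι θ t ht hθ
  · intro h ι _ θ t ht hθ
    exact h t ht ι θ hθ

/-- **`CurrencyLifting` — from the point property at generic points to the crux slice.** For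
`t ≥ 1`: the point property in every dimension `1 ≤ n ≤ t` implies the crux at exponent `t` for ALL
`θ ∈ ℂ^ι` with `trdeg ℚ(θ) ≤ t`. Mechanism: reindex so that `θ = (θ', θ'')` with `θ' ∈ ℂ^{t₀}` a
transcendence basis (`t₀ ≤ t`; `t₀ = 0`: `θ` algebraic, take `γ = θ`, cf. Disproof §4); apply
`PointAP t₀` at `θ'` to get `β'` with certificate `(d, S)`; lift each `θ''ⱼ`, a simple root of
`Fⱼ(θ', y)` (`Fⱼ ∈ ℤ[x', y]` irreducible), to the nearby root `βⱼ` of `Fⱼ(β', y)` (quantitative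
implicit function theorem: `|βⱼ − θ''ⱼ| ≤ C_θ‖β' − θ'‖` for `Δ ≥ c(θ)`); then
`[ℚ(β', β''):ℚ] ≤ d·∏ⱼ deg_y Fⱼ`, `d·h(βⱼ) ≤ C_θ(S + d)` (heights of specialisations — this is why
the input currency must be `(d, d·h)`, triage r1-1/2/3: per-coordinate naive heights do not lift),
and the naive certificates follow from `log H ≤ deg·log 2 + log M` with `Y ≥ Δ` absorbing every
`d·const` into `d·Y` and `(cΔ)ᵗ ≥ (cΔ)^{t₀}`, `Δ^{t-1} ≥ Δ^{t₀-1}` (Disproof `apWith_mono`). -/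
def CurrencyLifting : Prop :=
  ∀ t : ℕ, 1 ≤ t → (∀ n : ℕ, 1 ≤ n → n ≤ t → PointAP n) → APSlice t

/-! ## §4 The four stubs -/

/-- **Stub 1 — cycle property with postulation, `n ≤ 3`** (`CycleAPPostulated n` for `1 ≤ n ≤ 3`;
the REACHABLE HARD STUB). Why plausibly true: the bare 0-cycle property is Philippon's AP1 with
`d = 0`, PRINTED for `n ≤ 3` (LNM 1752 Ch. 4 §4 p. 61; Philippon, J. Number Theory 81 (2000),
doi:10.1006/jnth.1999.2461 — acq-02318, not held), whose descent cuts by Dirichlet-small forms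
`f₁,…,fₙ` of degree `≍ Δ` and follows closest components (LNM 1752 Ch. 8 Lemma 0.6/0.7 pp. 162–164);
the output orbit `O` lies in `Z₂·Z(fₙ)` with `Z₂` an irreducible curve, component of
`V(f₁,…,f_{n-1})` of degree `δ₂ ≤ Δ^{n-1}`, so `|O| ≤ δ₂Δ` (Bézout); if `fₙ` is in UNIFORM POSITION
w.r.t. `Z₂` (a Zariski-open condition on `fₙ` of bounded degree, paid by a polynomial-avoiding
Siegel lemma: Fukshansky 2006; Gaudron–Rémond Acta Arith. 154 (2012) Thm 2.2) every sub-orbit has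
`H_O(D) = min(|O|, H_{Z₂}(D))`, and Chardin–Philippon ("Régularité et interpolation", J. Algebraic
Geom. 8 (1999); Philippon IJNT 7 (2011) Lemme 3) give `H_{Z₂}(Δ/K) ≥ 2cₙ⁻¹ δ₂Δ/Kⁿ`, whence the
clause `d ≤ n!(Kc)ⁿ r` for `c ≥ cₙ`. `n = 1` is Laurent–Roy/Diaz (`H_O(D) = min(d, D+1)`). Why it
might fail: the avoidance must be threaded through the LAST Minkowski step of Philippon's descent
(whose forms are chosen by smallness at `θ`), and his proof for `n ≤ 3` must really produce
`Z₂` as a component of a complete intersection of the cutting forms (Massold arXiv:0711.3645 §4.1.1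
says this is exactly what holds up to codimension 3). Size: XL (vendoring Philippon 2000's
construction as Literature facts + the avoidance + CP's bound). Sources: NesterenkoPhilippon2001
Ch. 4 §4, Ch. 6–8; Philippon2000; ChardinPhilippon1999; GaudronRemond2012; Massold arXiv:0711.3645. -/
theorem stub_cyclePostulatedLow : ∀ n : ℕ, 1 ≤ n → n ≤ 3 → CycleAPPostulated n := by
  sorry

/-- **Stub 2 — cycle property with postulation, `n ≥ 4`** (`CycleAPPostulated n` for `4 ≤ n`; OPEN at
conjecture level). The bare statement is Philippon's AP1(`d = 0`) for `n ≥ 4` ("presently a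
conjecture", LNM 1752 p. 61; the only obstacle named in print is the effective lower bound for the
ARITHMETIC Hilbert function, Philippon IJNT 7 (2011) §1 — the target of the sibling card
`arithmetic-chardin-philippon`, whose template already carries an avoiding Siegel lemma, so the
postulation clause rides along). Why it might fail: with AP1 itself for `n ≥ 4`; the postulation
clause additionally needs the carrier curve `Z₂` to stay an isolated component of an intersection
of hypersurfaces of degree `≤ Δ` (for Chardin–Philippon), i.e. the all-dimension descent must not
lose the complete-intersection carrier (Massold's caveat). Size: open problem. Sources:
NesterenkoPhilippon2001 p. 61; Philippon2011 (doi:10.1142/s1793042111004502); Liu arXiv:2410.12821;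
GaudronRemond2012. -/
theorem stub_cyclePostulatedHigh : ∀ n : ℕ, 4 ≤ n → CycleAPPostulated n := by
  sorry

/-- **Stub 3 — generic extraction** (`OrbitExtraction n`, all `n ≥ 1`; THE LEVER of the card;
provable now). Why true: the four-step argument (A)–(D) in the docstring of `OrbitExtraction`;
the three triagers re-derived the own-level numerology independently and it transfers verbatim to
the scale level `⌊Δ/K⌋` (kill iff `n⌊Δ/K⌋S ≤ P/12`, i.e. `K ≥ 12nc`; supply iff `r ≥ 8` free
coefficients beyond `d/(n!(Kc)ⁿ)`; bounded `d` trivial). Why it might fail (as typed): only through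
the currency — the product formula needs `Σ_w log⁺|βᵢ|_w ≤ S` for every coordinate, which is
exactly what the IRREDUCIBLE certificates give (`d·h(βᵢ) ≤ S`), and `|s| ≤ #conjugates ≤ d`, which
is what `IsConj` + `finrank ≤ d` give. Size: L (Mathlib: `NumberField` product formula /
`Height.mulHeight`, `Algebra.norm`, `minpoly`, `Polynomial.mahlerMeasure`, Mignotte
`norm_coeff_le_choose_mul_mahlerMeasure`, pigeonhole `Finset.exists_ne_map_eq_of_card_lt_of_maps_to`,
Siegel `Int.Matrix.exists_ne_zero_int_vec_norm_le`; to build: conjugates `IsConj` ↔ embeddings of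
`ℚ(β)`, the Lipschitz bound for integer polynomials on the unit polydisc about `θ`). Sources:
NesterenkoPhilippon2001 Ch. 8 Cor. 0.8 (pp. 164–165, SMBT on the empty cycle); LaurentRoy1999
Lemmas 3–4 (the `n = 1` discriminant device it replaces); Waldschmidt2000 §3.5 (Liouville
inequalities via the product formula); Massold arXiv:0711.3645 §4.2 Prop. 4.2.1–2 (approximation
triples: same product-formula core, level taken from the previous construction step). -/
theorem stub_orbitExtraction : ∀ n : ℕ, 1 ≤ n → OrbitExtraction n := by
  sorry

/-- **Stub 4 — currency lifting** (`CurrencyLifting`; provable now). Why true: see the docstring of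
`CurrencyLifting` (transcendence basis + implicit roots + Mahler → naive height + monotonicity in
`t`). Why it might fail (as typed): at truth level only with the crux itself at a generic point —
the hypothesis is used at the projection `θ'` of `θ` to a transcendence basis and all constants may
depend on `θ` (Disproof §2 forces `c(θ) ≳ log⁺‖θ‖` anyway); the delicate points are bookkeeping:
`1 ≤ t` (Disproof §1) for the `t₀ = 0` branch and the degree budget, and `Δ ≤ Y` to absorb
`d·(log 2 + C_θ)` into `d·Y`. Size: L (Mathlib: `Algebra.trdeg`, `IsTranscendenceBasis`,
`exists_isTranscendenceBasis'`, `minpoly`, `Polynomial.mahlerMeasure`,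
`norm_coeff_le_choose_mul_mahlerMeasure`, `mahlerMeasure_le_sum_norm_coeff`; to build: a
quantitative simple-root continuity (Rouché / Newton–Kantorovich in one variable) and the height of
a specialised polynomial). Sources: NesterenkoPhilippon2001 Ch. 4 §4 (AP2 ⟹ affine), LaurentRoy1999
§§5–6 (the `t = 1` lifting to a curve), Waldschmidt2000 Ch. 3 (heights, Liouville inequalities). -/
theorem stub_currencyLifting : CurrencyLifting := by
  sorry

/-! ## §5 Composition (PROVED): cycle + extraction ⟹ point property; stubs ⟹ crux -/

/-- **Cycle + extraction ⟹ point property** in dimension `n` (pure logic and monotone budgets: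
the constant is `max c' Δ₀` with `K, c'` from the extraction at the cycle's `c`, and `Δ₀` the
cycle's threshold at that `K`). -/
theorem pointAP_of (hC : CycleAPPostulated n) (hE : OrbitExtraction n) : PointAP n := by
  intro θ
  obtain ⟨c, hc1, hcyc⟩ := hC θ
  obtain ⟨K, c', hK, hcc', hext⟩ := hE θ c hc1
  obtain ⟨Δ₀, hcycK⟩ := hcyc K hK
  refine ⟨max c' Δ₀, le_max_of_le_left (hc1.trans hcc'), fun Δ Y hΔ hY => ?_⟩
  have hc'Δ : c' ≤ Δ := (le_max_left _ _).trans hΔ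
  have hΔ₀Δ : Δ₀ ≤ Δ := (le_max_right _ _).trans hΔ
  have hcΔ : c ≤ Δ := hcc'.trans hc'Δ
  have hc0 : 0 ≤ c := zero_le_one.trans hc1
  have hΔ0 : 0 ≤ Δ := (hc0.trans hcΔ)
  have hY0 : 0 ≤ Y := hΔ0.trans hY
  have hcm : c ≤ max c' Δ₀ := hcc'.trans (le_max_left _ _)
  obtain ⟨β, d, S, s, r, hcert, hbud, hclose, hpost, hdr⟩ := hcycK Δ Y hΔ₀Δ hY
  obtain ⟨β', -, hcert', hdist⟩ :=
    hext Δ Y hc'Δ hY β d S s r hcert hbud.1 hclose hpost hdr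
  refine ⟨β', d, S, hcert', ⟨?_, ?_⟩, hdist.trans ?_⟩
  · exact hbud.1.trans
      (pow_le_pow_left₀ (mul_nonneg hc0 hΔ0) (mul_le_mul_of_nonneg_right hcm hΔ0) n)
  · exact hbud.2.trans
      (mul_le_mul_of_nonneg_right (mul_le_mul_of_nonneg_right hcm hY0) (pow_nonneg hΔ0 _))
  · -- monotonicity of the accuracy in the constant: `c' ≤ max c' Δ₀`, `0 ≤ S·Δ + d·Y`
    have hnum : 0 ≤ S * Δ + d * Y := by
      have hS : 0 ≤ S := hcert'.1
      positivity
    have hc'0 : 0 < c' := lt_of_lt_of_le (zero_lt_one.trans_le hc1) hcc'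
    rw [Real.exp_le_exp, neg_le_neg_iff]
    exact div_le_div_of_nonneg_left hnum hc'0 (le_max_left _ _)

/-- The cycle property with postulation in every dimension `n ≥ 1`, from stubs 1 and 2. -/
theorem cycleAPPostulated_all (n : ℕ) (hn : 1 ≤ n) : CycleAPPostulated n := by
  by_cases h3 : n ≤ 3
  · exact stub_cyclePostulatedLow n hn h3
  · exact stub_cyclePostulatedHigh n (by omega)

/-- The point property in every dimension `n ≥ 1`, from stubs 1, 2, 3. -/
theorem pointAP_all (n : ℕ) (hn : 1 ≤ n) : PointAP n :=
  pointAP_of (cycleAPPostulated_all n hn) (stub_orbitExtraction n hn)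

/-- **The crux from the line** — the ONLY theorem of this file concluding
`Summit.Schanuel.Schanuel.Theses.DiophantineDichotomy.ApproximationProperty`, BY NAME; no
hypotheses, the four registered stubs are INVOKED (sorries live only in `stub_*`). Chain:
stubs 1+2 (`cycleAPPostulated_all`) + stub 3 ⟹ `PointAP n` for all `n ≥ 1` (`pointAP_of`, proved) ⟹
`APSlice t` for all `t ≥ 1` (stub 4) ⟹ the crux (`approximationProperty_iff_apSlice`). -/
theorem ApproximationProperty_of : ApproximationProperty :=
  approximationProperty_iff_apSlice.mpr fun t ht =>
    stub_currencyLifting t ht fun n hn _ => pointAP_all n hn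

/-- **Stand-alone pay-off of the line (kernel-checked dependency): the crux for `t ≤ 3` needs only
stubs 1, 3, 4** — in particular the first open case `t = 3` follows from Philippon 2000's descent
with a uniform-position last cut (stub 1), the lever (stub 3) and the lifting (stub 4), without AP1
for `n ≥ 4`. -/
theorem apSlice_le_three_of (hC : ∀ n : ℕ, 1 ≤ n → n ≤ 3 → CycleAPPostulated n)
    (hE : ∀ n : ℕ, 1 ≤ n → OrbitExtraction n) (hL : CurrencyLifting)
    (t : ℕ) (ht : 1 ≤ t) (ht3 : t ≤ 3) : APSlice t :=
  hL t ht fun n hn hnt => pointAP_of (hC n hn (hnt.trans ht3)) (hE n hn)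

/-! ## §6 The landed Negative lemmas are in scope (no statement of this file has a refuted shape:
exponent `t = 0`, a constant uniform in `θ`, or the scale exponent `exp(−ΔY/c)`) -/

example := Summit.Schanuel.Schanuel.Theorems.ApproximationPropertyShape.false_without_pos_t
example := Summit.Schanuel.Schanuel.Theorems.ApproximationPropertyShape.false_with_uniform_constant
example :=
  Summit.Schanuel.Schanuel.Theorems.ApproximationPropertyScaleExponentLiouville.scaleExponent_false

/-- The line's slices are slices of the crux in the sense of Disproof §0: `APSlice 1` is literally
the support item `ApproximationPropertyDegOne` (stmt-Schanuel-11037) up to `(cΔ)^1 = cΔ`,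
`Δ^0 = 1` — so stub 1 at `n = 1` + stubs 3, 4 reprove the known `t = 1` case (Laurent–Roy 1999 /
Diaz 1997), a consistency check for the lead before attacking `n = 2, 3`. -/
theorem degOne_of_apSlice_one (h : APSlice 1) :
    Summit.Schanuel.Schanuel.Theses.DiophantineDichotomy.ApproximationPropertyDegOne := by
  intro ι _ θ hθ
  obtain ⟨c, hc, hall⟩ := h ι θ (by simpa using hθ)
  refine ⟨c, hc, fun Δ Y hΔ hY => ?_⟩
  obtain ⟨γ, d, H, h1, h2, h3, h4, h5⟩ := hall Δ Y hΔ hY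
  exact ⟨γ, d, H, h1, h2, by simpa using h3, by simpa using h4, h5⟩

end Summit.Schanuel.Schanuel.Cruxes.ApproximationProperty.ClusterKillingOwnLevel

end
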